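import Summits.BirchSwinnertonDyer.BirchSwinnertonDyer.Theorems.PrintCf2SplitBadTwoLineLocalDefectVbarLocal
import Summits.BirchSwinnertonDyer.BirchSwinnertonDyer.Theorems.PrintCf2SplitBadTwoLocalControlKernelDyadicSeven
import HarnessLib

/-!
# Road α, crux `PrintCf2.SplitBadTwoRankOneOfFacts` (stmt-BirchSwinnertonDyer-20368), stub S3d — the local defect `Def(v̄)` VANISHES on the frames with
# `d ≡ 6 (mod 16)` (key (0,3): a NON-inertial mover and `I_v̄ ∩ ker κ'` trivial on `W*`)

Cell `bsd-print-cf2`, width seat `bsd-line-cf2-p1-w6` g5 (S3d: «𝓗 local + ch(𝓗^∨)(0) per class», continuing -w6 g4); `--supports stmt-BirchSwinnertonDyer-20368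
--as helper`. HONEST FRAMING: nothing here closes the crux or a registered stub; no summit statement is proved by this seat; BSD is not proved by any of this.
No definition, no named fact, no `sorry`.

Frame: member `C • W = cm7^{(d)}`, `d = 2d'`, `K` imaginary quadratic, `2 = v v̄`, `W* = ↥((W.baseChange K).endEigenPrimaryTorsion 2 π r)` pinned at `v`, `κ'` the
`ℤ₂`-line unramified outside `v̄` (the line `K*_∞`). With the NAMED local type at `v̄` (`endEigenPrimaryTorsion_two_localTypes_named_of_pinned`: `σ` of Frobenius
degree `n` acts on `W*[2^k]` as `χ_d(σ)·ε(σ)·α^{−n}`), (C3) `mem_kerSubgroup_iff_smul_of_frame` (`ker κ'` acts by signs) and B15's mod-`8` square-root signs: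
* **`smul_eq_self_of_mem_inertia_vbar_of_kerSubgroup_of_frame_even_three`** (`d' ≡ 3 (mod 4)`, i.e. `d ≡ 6, 14 (mod 16)`): an element of `I_v̄ ∩ ker κ'` acts
  TRIVIALLY on `W*` — an inertia element fixes `√(−d')` (`−d' ≡ 1 (mod 4)`), so its sign on `ι√d = ±ι√(−2)·√(−d')` is its sign on `ι√(−2)`, i.e. `+1` iff
  `ε ≡ 1, 3 (mod 8)`; hence it acts on a generator of `W*[8]` as `χ_d·ε ∈ {1·1, 1·3, (−1)·5, (−1)·7} ≡ {1, 3} (mod 8)`, never as `−1`.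
* **`exists_mover_vbar_of_frame_even_three`** (`d' ≡ 3 (mod 8)`, i.e. `d ≡ 6 (mod 16)`): some `δ₀ ∈ D_v̄ ∩ ker κ'` acts as `−1` on all of `W*` — `σ = φ·τ` of
  degree one with `ε(σ) = α ≡ 3 (mod 8)` fixes `ι√(−2)`, `φ` negates and `τ` fixes `√(−d')` (`−d' ≡ 5 (mod 8)`, `#𝓀(K_v̄) = 2`), so `χ_d(σ) = −1` and `σ` acts as
  `−ε(σ)·α⁻¹ = −1` (the mover of B15 file 11 `natCard_localKer_vbar_eq_two_of_frame_of_kerC3_even_three`, exported with (C3-loc) discharged by (C3)).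
* **`greenbergKer_strictDatum_vbar_eq_awayKer_of_frame_even_three`**, **`localDefect_vbar_eq_bot_of_frame_even_three`** (`d ≡ 6 (mod 16)`): over the line
  `K*_∞`, UNRAMIFIED = STRICT above `v̄` for `W*` (`greenbergKer_strictDatum_eq_awayKer_of_mover`) and the local defect group
  `Def(κ', W*, v̄) = ker(H¹(ker κ' ⊓ D_v̄, W*) → H¹(ker κ' ⊓ I_v̄, W*)) = ⊥` (`localDefect_eq_bot_of_mover`) — exactly as on `d ≡ 7 (mod 8)` (p688903, p690267).
  So the class (ii) of S3d (`e_δ = 0` with NO local defect) is `d ≡ 7 (mod 8)` ∪ `d ≡ 6 (mod 16)`.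

presearch: Rubin LNM 1716 §3 Lemma 3.6 (ii), Cor. 3.17 (local structure of `E[𝔭^∞]`); Greenberg LNM 1716 §3; Agboola 2007 §3 Prop. 3.2; Serre 1968 Ch. I §1.2
(`χ_2`, `χ_{−2}` via `ζ₈`) — held; tree assembly, no new fact. beyond-print theorem: no.

References: [Rubin1999] §3 Lemma 3.6 (ii), Cor. 3.17; [GreenbergLNM1716] §3; [Agboola2007] §3 Prop. 3.2; [SerreAbelianLadic1968] Ch. I §1.2;
[NeukirchANT1999] II Prop. (7.12), (7.13).
-/

noncomputable section

open scoped Classical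

set_option linter.dupNamespace false
set_option autoImplicit false

open NumberField IsDedekindDomain Field WeierstrassCurve
open Literature.NumberTheory.EllipticCurves Literature.NumberTheory.EllipticCurves.GreenbergSelmer
open Literature.NumberTheory.GaloisRepresentations
open Summit.BirchSwinnertonDyer.BirchSwinnertonDyer.Theorems.PrintCf2.AdditiveAtSeven
open Summit.BirchSwinnertonDyer.BirchSwinnertonDyer.Theorems.PrintCf2.CMPrimes
open Summit.BirchSwinnertonDyer.BirchSwinnertonDyer.Theorems.PrintCf2.RestrictedSelmerPair
open Summit.BirchSwinnertonDyer.BirchSwinnertonDyer.Theorems.PrintCf2.SplitPrimeLine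

namespace Summit.BirchSwinnertonDyer.BirchSwinnertonDyer.Theorems.PrintCf2.LineLocallyTrivial

variable {K : Type} [Field K] [NumberField K]

/-! ## §1. `I_v̄ ∩ ker κ'` acts trivially on `W*` (`d = 2d'`, `d' ≡ 3 (mod 4)`) -/

/-- **On a frame with `d = 2d'`, `d' ≡ 3 (mod 4)` (`d ≡ 6, 14 (mod 16)`), every element of `I_v̄ ∩ ker κ'` acts TRIVIALLY on `W*`.** By (C3) it acts as
`+1` or `−1`; writing it as `res σ` with `σ ∈ I(K̄_v̄/K_v̄)`, `σ` fixes `√(−d')` (`−d' ≡ 1 (mod 4)`), so its sign on `ι√d` is its sign on `ι√(−2)` (`+1` iff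
`ε(σ) ≡ 1, 3 (mod 8)`), and the named local type makes it act on a generator `g₈` of `W*[8]` as `1` or `3`; an element acting as `−1` would give `2g₈ = 0` or
`4g₈ = 0`. [cite: Rubin1999, §3 Lemma 3.6 (ii) and Cor. 3.17] [cite: SerreAbelianLadic1968, Ch. I §1.2] -/
theorem smul_eq_self_of_mem_inertia_vbar_of_kerSubgroup_of_frame_even_three {d : ℤ} (hd0 : d ≠ 0) (h2d : (2 : ℤ) ∣ d) (hd3 : (d / 2) % 4 = 3)
    (W : WeierstrassCurve ℚ) [W.IsElliptic] (C : VariableChange ℚ) (hC : C • W = cm7.quadraticTwist (d : ℚ)) (hK : IsImaginaryQuadratic K)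
    (v vbar : HeightOneSpectrum (𝓞 K)) (hv : ((2 : ℕ) : 𝓞 K) ∈ v.asIdeal) (hvbar : ((2 : ℕ) : 𝓞 K) ∈ vbar.asIdeal) (hne : vbar ≠ v)
    (π : (W.baseChange K).endRing) (hrel : (π : AddMonoid.End (W.baseChange K).geomPoints) * π = π - 2) {r : ℤ_[2]} (hr : r * r = r - 2)
    (hpin : ∀ τ ∈ GreenbergSelmer.inertia v, ∀ x : ↥((W.baseChange K).endEigenPrimaryTorsion 2 π r), τ • x = x ∨ τ • x = -x)
    (κ' : ZpExtension K 2) (hκ' : κ'.IsUnramifiedOutside vbar)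
    {τ : absoluteGaloisGroup K} (hτI : τ ∈ GreenbergSelmer.inertia vbar) (hτκ : τ ∈ κ'.kerSubgroup)
    (x : ↥((W.baseChange K).endEigenPrimaryTorsion 2 π r)) : τ • x = x := by
  haveI : Fact (Nat.Prime 2) := ⟨Nat.prime_two⟩
  have hj : W.j = -3375 := j_eq_of_smul_eq_cm7Twist hd0 W C hC
  obtain ⟨θ, hθ⟩ := exists_sq_eq_neg_seven_of_cmEndo_mem_endRing W K hj π hrel
  have hK2 : Module.finrank ℚ K = 2 := hK.1
  rcases (mem_kerSubgroup_iff_smul_of_frame hd0 W C hC hK v vbar hv hvbar hne π hrel hr hpin κ' hκ' τ).mp hτκ with h | h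
  · exact h x
  · exfalso
    -- a generator `g₈` of `W*[8]`
    obtain ⟨-, -, -, -, -, -, hgen, -⟩ := endEigenPrimaryTorsion_two_structure W hj K hθ π hrel hr
    obtain ⟨g₈, hg₈, hord8, -⟩ := hgen 3
    have h8 : 2 ^ 3 • g₈ = 0 := by rw [← hord8]; exact addOrderOf_nsmul_eq_zero g₈
    -- the kernel-type clause (R) at `v̄` for `E[𝔮_r^∞]` and the named local type
    obtain ⟨hcl', -⟩ := endEigenPrimaryTorsion_two_pinningClause_swap W K hj hK hθ π hrel hr hv hvbar hne hpin
    have hcl'' : ∀ τ ∈ GreenbergSelmer.inertia vbar, ∀ y ∈ (W.baseChange K).endEigenPrimaryTorsion 2 π (1 - r),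
        τ • y = y ∨ τ • y = -y := fun τ hτ y hy ↦ by
      rcases hcl' τ hτ ⟨y, hy⟩ with h | h
      · exact Or.inl (congrArg Subtype.val h)
      · exact Or.inr (congrArg Subtype.val h)
    have h1r : (1 - r) * (1 - r) = (1 - r) - 2 := by linear_combination hr
    have hdQ : (d : ℚ) ≠ 0 := by exact_mod_cast hd0
    obtain ⟨α, hα, -, hUR⟩ := endEigenPrimaryTorsion_two_localTypes_named_of_pinned W K hj hθ π hrel h1r hdQ C hC vbar hvbar
      (inertiaDeg_eq_one_of_ne_two K hK2 hvbar hv hne.symm) hcl''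
    simp only [sub_sub_cancel] at hUR
    have HR := fun σ n hσ s hs ↦ (hUR σ n hσ s hs).2
    -- `d = 2d'`, `−d' ≡ 1 (mod 4)`
    obtain ⟨d', rfl⟩ := h2d
    have hm4 : (-d') % 4 = 1 := by omega
    -- `τ = res σ` with `σ ∈ I_{K_v̄}`
    obtain ⟨σ, hσI, hστ⟩ := Subgroup.mem_map.mp hτI
    have hσ0 : IsFrobPow σ ((0 : ℕ) : ℤ) := by exact_mod_cast isFrobPow_zero_iff_mem_absInertia.mpr hσI
    -- square roots: `B = √(−d')` (fixed by inertia), `X = ι√(−2)`, `A = ι√d`, `(X·B)² = A²`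
    set B := WeierstrassCurve.geomSqrt ((-d' : ℤ) : K) with hB_def
    have hBfix : absGaloisRestrict K (vbar.adicCompletion K) σ • B = ((1 : ℤ) : AlgebraicClosure K) * B := by
      rw [Int.cast_one, one_mul, hB_def]
      exact smul_geomSqrt_eq_of_mem_absInertia_of_emod_four_eq_one vbar hvbar hm4 hσI
    set X := absClosureEmbedding ℚ K (WeierstrassCurve.geomSqrt (-2 : ℚ)) with hX_def
    set A := absClosureEmbedding ℚ K (WeierstrassCurve.geomSqrt (((2 * d' : ℤ)) : ℚ)) with hA_def
    have hXY : (X * B) ^ 2 = A ^ 2 := by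
      rw [mul_pow, hX_def, hA_def, hB_def, ← map_pow, ← map_pow, WeierstrassCurve.geomSqrt_sq, WeierstrassCurve.geomSqrt_sq,
        WeierstrassCurve.geomSqrt_sq, AlgHom.commutes, AlgHom.commutes]
      simp only [map_intCast, map_neg, map_ofNat, map_mul, Int.cast_mul, Int.cast_ofNat, Int.cast_neg]
      ring
    have hmem8 : ∀ z : ℤ_[2], PadicInt.toZModPow 3 z = 0 → z ∈ (Ideal.span {(2 : ℤ_[2]) ^ 3} : Ideal ℤ_[2]) := by
      intro z hz
      have h := (RingHom.mem_ker (f := PadicInt.toZModPow (p := 2) 3)).mpr hz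
      rw [PadicInt.ker_toZModPow] at h
      simpa only [Nat.cast_ofNat] using h
    -- the local character at the inertia element `σ`: `res σ • g₈ ∈ {g₈, 3g₈}`
    set u : ℤ_[2]ˣ := GaloisRep.cyclotomicCharacter K 2 (absGaloisRestrict K (vbar.adicCompletion K) σ) with hu
    have htu : IsUnit (PadicInt.toZModPow 3 (u : ℤ_[2])) := (Units.isUnit u).map _
    have leaf : ∀ s N : ℤ,
        ((absGaloisRestrict K (vbar.adicCompletion K) σ • A = A ∧ s = 1) ∨ (absGaloisRestrict K (vbar.adicCompletion K) σ • A = -A ∧ s = -1)) →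
        (N = 1 ∨ N = 3) → PadicInt.toZModPow 3 ((N : ℤ_[2]) - (s : ℤ_[2]) * ((u * (α⁻¹) ^ 0 : ℤ_[2]ˣ) : ℤ_[2])) = 0 →
        absGaloisRestrict K (vbar.adicCompletion K) σ • g₈ = g₈ ∨ absGaloisRestrict K (vbar.adicCompletion K) σ • g₈ = 3 • g₈ := by
      intro s N hs hN h0
      have hact := HR σ 0 hσ0 s (by rw [hA_def] at hs; exact_mod_cast hs) 3 g₈ hg₈ h8 N (hmem8 _ (by rw [hu] at h0; exact h0))
      rcases hN with rfl | rfl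
      · left; rwa [one_zsmul] at hact
      · right; rwa [show (3 : ℤ) = ((3 : ℕ) : ℤ) from rfl, natCast_zsmul] at hact
    -- the sign of `res σ` on `ι√d` is its sign on `ι√(−2)`
    have hXs := smul_geomSqrt_neg_two_eq_of_cyclotomicCharacter K (absGaloisRestrict K (vbar.adicCompletion K) σ)
    rw [← hu] at hXs
    have hplus : (PadicInt.toZModPow 3 (u : ℤ_[2]) = 1 ∨ PadicInt.toZModPow 3 (u : ℤ_[2]) = 3) →
        absGaloisRestrict K (vbar.adicCompletion K) σ • A = A := fun ht ↦ by
      have hX1 : absGaloisRestrict K (vbar.adicCompletion K) σ • X = ((1 : ℤ) : AlgebraicClosure K) * X := by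
        rw [Int.cast_one, one_mul]; exact hXs.1 ht
      have h := smul_eq_intCast_mul_of_sq_eq _ hXY hX1 hBfix
      rwa [show ((1 * 1 : ℤ) : AlgebraicClosure K) = 1 by norm_num, one_mul] at h
    have hminus : (PadicInt.toZModPow 3 (u : ℤ_[2]) = 5 ∨ PadicInt.toZModPow 3 (u : ℤ_[2]) = 7) →
        absGaloisRestrict K (vbar.adicCompletion K) σ • A = -A := fun ht ↦ by
      have hX1 : absGaloisRestrict K (vbar.adicCompletion K) σ • X = ((-1 : ℤ) : AlgebraicClosure K) * X := by
        rw [Int.cast_neg, Int.cast_one, neg_one_mul]; exact hXs.2 ht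
      have h := smul_eq_intCast_mul_of_sq_eq _ hXY hX1 hBfix
      rwa [show ((-1 * 1 : ℤ) : AlgebraicClosure K) = -1 by norm_num, neg_one_mul] at h
    have hval : ∀ s N : ℤ, PadicInt.toZModPow 3 ((N : ℤ_[2]) - (s : ℤ_[2]) * ((u * (α⁻¹) ^ 0 : ℤ_[2]ˣ) : ℤ_[2])) =
        (N : ZMod (2 ^ 3)) - (s : ZMod (2 ^ 3)) * PadicInt.toZModPow 3 (u : ℤ_[2]) := by
      intro s N
      rw [pow_zero, mul_one, map_sub, map_mul, map_intCast, map_intCast]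
    have key : absGaloisRestrict K (vbar.adicCompletion K) σ • g₈ = g₈ ∨ absGaloisRestrict K (vbar.adicCompletion K) σ • g₈ = 3 • g₈ := by
      rcases zmod_eight_unit_cases _ htu with ht | ht | ht | ht
      · exact leaf 1 1 (Or.inl ⟨hplus (Or.inl ht), rfl⟩) (Or.inl rfl) (by rw [hval, ht]; decide)
      · exact leaf 1 3 (Or.inl ⟨hplus (Or.inr ht), rfl⟩) (Or.inr rfl) (by rw [hval, ht]; decide)
      · exact leaf (-1) 3 (Or.inr ⟨hminus (Or.inl ht), rfl⟩) (Or.inr rfl) (by rw [hval, ht]; decide)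
      · exact leaf (-1) 1 (Or.inr ⟨hminus (Or.inr ht), rfl⟩) (Or.inl rfl) (by rw [hval, ht]; decide)
    -- but `τ = res σ` acts as `−1`
    have h2g : 2 • g₈ ≠ 0 := fun h ↦ by
      have hdvd : addOrderOf g₈ ∣ 2 := addOrderOf_dvd_of_nsmul_eq_zero h
      rw [hord8] at hdvd
      exact absurd (Nat.le_of_dvd two_pos hdvd) (by norm_num)
    have h4g : 4 • g₈ ≠ 0 := fun h ↦ by
      have hdvd : addOrderOf g₈ ∣ 4 := addOrderOf_dvd_of_nsmul_eq_zero h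
      rw [hord8] at hdvd
      exact absurd (Nat.le_of_dvd (by norm_num) hdvd) (by norm_num)
    have hneg := congrArg Subtype.val (h ⟨g₈, hg₈⟩)
    change τ • g₈ = -g₈ at hneg
    have hτσ : τ = (absGaloisRestrict K (vbar.adicCompletion K)).toMonoidHom σ := hστ.symm
    rw [hτσ] at hneg
    change absGaloisRestrict K (vbar.adicCompletion K) σ • g₈ = -g₈ at hneg
    rcases key with h1 | h3
    · rw [h1] at hneg
      exact h2g (by rw [two_nsmul]; exact add_eq_zero_iff_eq_neg.mpr hneg)
    · rw [h3] at hneg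
      exact h4g (by rw [show (4 : ℕ) = 3 + 1 from rfl, add_nsmul, one_nsmul, hneg, neg_add_cancel])

/-! ## §2. A mover in `D_v̄ ∩ ker κ'` exists (`d = 2d'`, `d' ≡ 3 (mod 8)`) -/

/-- **On a frame with `d = 2d'`, `d' ≡ 3 (mod 8)` (`d ≡ 6 (mod 16)`), some `δ₀ ∈ D_v̄ ∩ ker κ'` acts as `−1` on all of `W*`.** Take `φ` of Frobenius
degree one and the inertia element `τ` with `ε(τ) = α·ε(φ)⁻¹`; then `σ = φ·τ` has degree one and `ε(σ) = α ≡ 3 (mod 8)`, so it fixes `ι√(−2)`, while `φ`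
negates and `τ` fixes `√(−d')` (`−d' ≡ 5 (mod 8)`, `#𝓀(K_v̄) = 2`): `χ_d(σ) = −1` and `σ` acts on every `W*[2^k]` as `−ε(σ)·α⁻¹ = −1`; it lies in `ker κ'` by
(C3). (B15 file 11's mover, exported.) [cite: Rubin1999, §3 Lemma 3.6 (ii) and Cor. 3.17] [cite: SerreAbelianLadic1968, Ch. I §1.2]
[cite: NeukirchANT1999, II Prop. (7.13)] -/
theorem exists_mover_vbar_of_frame_even_three {d : ℤ} (hd0 : d ≠ 0) (h2d : (2 : ℤ) ∣ d) (hd3 : (d / 2) % 8 = 3)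
    (W : WeierstrassCurve ℚ) [W.IsElliptic] (C : VariableChange ℚ) (hC : C • W = cm7.quadraticTwist (d : ℚ)) (hK : IsImaginaryQuadratic K)
    (v vbar : HeightOneSpectrum (𝓞 K)) (hv : ((2 : ℕ) : 𝓞 K) ∈ v.asIdeal) (hvbar : ((2 : ℕ) : 𝓞 K) ∈ vbar.asIdeal) (hne : vbar ≠ v)
    (π : (W.baseChange K).endRing) (hrel : (π : AddMonoid.End (W.baseChange K).geomPoints) * π = π - 2) {r : ℤ_[2]} (hr : r * r = r - 2)
    (hpin : ∀ τ ∈ GreenbergSelmer.inertia v, ∀ x : ↥((W.baseChange K).endEigenPrimaryTorsion 2 π r), τ • x = x ∨ τ • x = -x)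
    (κ' : ZpExtension K 2) (hκ' : κ'.IsUnramifiedOutside vbar) :
    ∃ δ₀ ∈ GreenbergSelmer.decomp vbar, δ₀ ∈ κ'.kerSubgroup ∧ ∀ x : ↥((W.baseChange K).endEigenPrimaryTorsion 2 π r), δ₀ • x = -x := by
  haveI : Fact (Nat.Prime 2) := ⟨Nat.prime_two⟩
  have hj : W.j = -3375 := j_eq_of_smul_eq_cm7Twist hd0 W C hC
  obtain ⟨θ, hθ⟩ := exists_sq_eq_neg_seven_of_cmEndo_mem_endRing W K hj π hrel
  have hK2 : Module.finrank ℚ K = 2 := hK.1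
  -- the kernel-type clause (R) at `v̄` for `E[𝔮_r^∞]` and the named local type
  obtain ⟨hcl', -⟩ := endEigenPrimaryTorsion_two_pinningClause_swap W K hj hK hθ π hrel hr hv hvbar hne hpin
  have hcl'' : ∀ τ ∈ GreenbergSelmer.inertia vbar, ∀ y ∈ (W.baseChange K).endEigenPrimaryTorsion 2 π (1 - r),
      τ • y = y ∨ τ • y = -y := fun τ hτ y hy ↦ by
    rcases hcl' τ hτ ⟨y, hy⟩ with h | h
    · exact Or.inl (congrArg Subtype.val h)
    · exact Or.inr (congrArg Subtype.val h)
  have h1r : (1 - r) * (1 - r) = (1 - r) - 2 := by linear_combination hr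
  have hdQ : (d : ℚ) ≠ 0 := by exact_mod_cast hd0
  obtain ⟨α, hα, -, hUR⟩ := endEigenPrimaryTorsion_two_localTypes_named_of_pinned W K hj hθ π hrel h1r hdQ C hC vbar hvbar
    (inertiaDeg_eq_one_of_ne_two K hK2 hvbar hv hne.symm) hcl''
  simp only [sub_sub_cancel] at hUR
  have HR := fun σ n hσ s hs ↦ (hUR σ n hσ s hs).2
  have hq := residueFieldCard_adicCompletion_eq_two_of_frame hd0 W hC hK hθ hvbar
  -- `d = 2d'`, `d' ≡ 3 (mod 8)`
  obtain ⟨d', rfl⟩ := h2d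
  have hd'3 : d' % 8 = 3 := by omega
  -- `φ` of degree one and the inertia partner `τ` with `ε(τ) = α·ε(φ)⁻¹`
  obtain ⟨φ, hφ1⟩ := exists_isFrobPow_holds (F := vbar.adicCompletion K) 1
  set εφ : ℤ_[2]ˣ := GaloisRep.cyclotomicCharacter K 2 (absGaloisRestrict K (vbar.adicCompletion K) φ) with hεφ
  obtain ⟨τ, hτI, hτχ⟩ := ZpExtension.exists_mem_inertia_cyclotomicCharacter_eq_of_split hK2 hv hvbar hne
    (adicCompletionPrime_mem_primesAbove K vbar) (α * εφ⁻¹)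
  rw [inertia_adicCompletionPrime_eq_map_absInertia K vbar, Subgroup.mem_map] at hτI
  obtain ⟨στ, hστI, hσττ⟩ := hτI
  have hτχ' : GaloisRep.cyclotomicCharacter K 2 (absGaloisRestrict K (vbar.adicCompletion K) στ) = α * εφ⁻¹ := by
    rw [← hτχ]; exact congrArg _ hσττ
  have hεσ : GaloisRep.cyclotomicCharacter K 2 (absGaloisRestrict K (vbar.adicCompletion K) (φ * στ)) = α := by
    rw [map_mul, map_mul, hτχ', ← hεφ, mul_comm, inv_mul_cancel_right]
  have hσ1 : IsFrobPow (φ * στ) ((1 : ℕ) : ℤ) := by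
    have h := IsFrobPow.mul_holds hφ1 (isFrobPow_zero_iff_mem_absInertia.mpr hστI)
    rw [add_zero] at h
    exact_mod_cast h
  -- `α ≡ 3 (mod 8)`
  have hα8 : PadicInt.toZModPow 3 ((α : ℤ_[2]ˣ) : ℤ_[2]) = 3 := by
    refine zmod_eight_unitRoot _ (PadicInt.toZModPow 3 ((α⁻¹ : ℤ_[2]ˣ) : ℤ_[2])) ?_ ?_
    · rw [← map_mul, ← Units.val_mul, mul_inv_cancel, Units.val_one, map_one]
    · have := congrArg (PadicInt.toZModPow 3) hα
      rwa [map_pow, map_sub, map_ofNat] at this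
  -- signs of `σ`: fixes `ι√(−2)`; sign `−1` on `√(−d')`; hence `−1` on `ι√d`
  have hX : absGaloisRestrict K (vbar.adicCompletion K) (φ * στ) • absClosureEmbedding ℚ K (WeierstrassCurve.geomSqrt (-2 : ℚ)) =
      ((1 : ℤ) : AlgebraicClosure K) * absClosureEmbedding ℚ K (WeierstrassCurve.geomSqrt (-2 : ℚ)) := by
    rw [Int.cast_one, one_mul]
    refine (smul_geomSqrt_neg_two_eq_of_cyclotomicCharacter K _).1 (Or.inr ?_)
    rw [hεσ, hα8]
  have hY : absGaloisRestrict K (vbar.adicCompletion K) (φ * στ) • WeierstrassCurve.geomSqrt ((-d' : ℤ) : K) =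
      ((-1 : ℤ) : AlgebraicClosure K) * WeierstrassCurve.geomSqrt ((-d' : ℤ) : K) := by
    rw [map_mul, mul_smul, smul_geomSqrt_eq_of_mem_absInertia_of_emod_four_eq_one vbar hvbar (u := -d') (by omega) hστI,
      smul_geomSqrt_eq_neg_of_isFrobPow_one_of_emod_eight_eq_five vbar hvbar hq (u := -d') (by omega) hφ1]
    push_cast; ring
  have hXY : (absClosureEmbedding ℚ K (WeierstrassCurve.geomSqrt (-2 : ℚ)) * WeierstrassCurve.geomSqrt ((-d' : ℤ) : K)) ^ 2 =
      absClosureEmbedding ℚ K (WeierstrassCurve.geomSqrt ((2 * d' : ℤ) : ℚ)) ^ 2 := by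
    rw [mul_pow, ← map_pow, ← map_pow, WeierstrassCurve.geomSqrt_sq, WeierstrassCurve.geomSqrt_sq, WeierstrassCurve.geomSqrt_sq,
      AlgHom.commutes, AlgHom.commutes]
    simp only [map_intCast, map_neg, map_ofNat, map_mul, Int.cast_mul, Int.cast_ofNat, Int.cast_neg]
    all_goals ring
  have hA := smul_eq_intCast_mul_of_sq_eq _ hXY hX hY
  rw [show ((1 * -1 : ℤ) : AlgebraicClosure K) = -1 by norm_num, neg_one_mul] at hA
  -- `σ` acts as `−1` on all of `W*`
  have hαinv : (α : ℤ_[2]) * ((α⁻¹ : ℤ_[2]ˣ) : ℤ_[2]) = 1 := by rw [← Units.val_mul, mul_inv_cancel, Units.val_one]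
  have hneg : ∀ x : ↥((W.baseChange K).endEigenPrimaryTorsion 2 π r), absGaloisRestrict K (vbar.adicCompletion K) (φ * στ) • x = -x := by
    intro x
    obtain ⟨k, hk⟩ := (AddCommGroup.mem_primaryComponent).mp (x : (W.baseChange K).geomPrimaryTorsion 2).2
    have hxk : 2 ^ k • (x : (W.baseChange K).geomPrimaryTorsion 2) = 0 :=
      Subtype.ext (by rw [AddSubmonoidClass.coe_nsmul, ZeroMemClass.coe_zero]; exact hk)
    have hmem : (((-1 : ℤ) : ℤ_[2]) - (-1 : ℤ) * ((GaloisRep.cyclotomicCharacter K 2 (absGaloisRestrict K (vbar.adicCompletion K) (φ * στ)) *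
        (α⁻¹) ^ 1 : ℤ_[2]ˣ) : ℤ_[2])) ∈ (Ideal.span {(2 : ℤ_[2]) ^ k} : Ideal ℤ_[2]) := by
      rw [hεσ, pow_one, Units.val_mul, hαinv]; simp
    have h := HR (φ * στ) 1 hσ1 (-1) (Or.inr ⟨by exact_mod_cast hA, rfl⟩) k x x.2 hxk (-1) hmem
    exact Subtype.ext (by rw [neg_one_zsmul] at h; exact h)
  refine ⟨absGaloisRestrict K (vbar.adicCompletion K) (φ * στ), ⟨φ * στ, rfl⟩, ?_, hneg⟩
  exact (mem_kerSubgroup_iff_smul_of_frame hd0 W C hC hK v vbar hv hvbar hne π hrel hr hpin κ' hκ' _).mpr (Or.inr hneg)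

/-! ## §3. UNRAMIFIED = STRICT above `v̄` over the line, and `Def(v̄) = ⊥`, on the frames with `d ≡ 6 (mod 16)` -/

/-- **UNRAMIFIED = STRICT ABOVE `v̄` OVER THE LINE `K*_∞` on the frames with `d ≡ 6 (mod 16)`**: for `W*` pinned at `v` and the `ℤ₂`-line `κ'` unramified outside
`v̄`, `(strictDatum W* v̄).greenbergKer (ker κ') = awayKer (ker κ') W* v̄` — `greenbergKer_strictDatum_eq_awayKer_of_mover` with: ramification at `v̄` (-w5 g4), signs
(C3), `I_v̄ ∩ ker κ'` trivial (§1), the mover (§2), divisibility and the unique element of order `2` (p688903 §3), open stabilisers.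
[cite: GreenbergLNM1716, §3] [cite: Rubin1999, §3 Lemma 3.6 (ii) and Cor. 3.17] [cite: Agboola2007, §3 Prop. 3.2] -/
theorem greenbergKer_strictDatum_vbar_eq_awayKer_of_frame_even_three {d : ℤ} (hd0 : d ≠ 0) (h2d : (2 : ℤ) ∣ d) (hd3 : (d / 2) % 8 = 3)
    (W : WeierstrassCurve ℚ) [W.IsElliptic] (C : VariableChange ℚ) (hC : C • W = cm7.quadraticTwist (d : ℚ)) (hK : IsImaginaryQuadratic K)
    (v vbar : HeightOneSpectrum (𝓞 K)) (hv : ((2 : ℕ) : 𝓞 K) ∈ v.asIdeal) (hvbar : ((2 : ℕ) : 𝓞 K) ∈ vbar.asIdeal) (hne : vbar ≠ v)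
    (π : (W.baseChange K).endRing) (hrel : (π : AddMonoid.End (W.baseChange K).geomPoints) * π = π - 2) {r : ℤ_[2]} (hr : r * r = r - 2)
    (hpin : ∀ τ ∈ GreenbergSelmer.inertia v, ∀ x : ↥((W.baseChange K).endEigenPrimaryTorsion 2 π r), τ • x = x ∨ τ • x = -x)
    (κ' : ZpExtension K 2) (hκ' : κ'.IsUnramifiedOutside vbar) :
    (Castella2018.AcSelmer.strictDatum ↥((W.baseChange K).endEigenPrimaryTorsion 2 π r) vbar).greenbergKer κ'.kerSubgroup =
      GreenbergSelmer.awayKer κ'.kerSubgroup ↥((W.baseChange K).endEigenPrimaryTorsion 2 π r) vbar := by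
  haveI : Fact (Nat.Prime 2) := ⟨Nat.prime_two⟩
  have hj : W.j = -3375 := j_eq_of_smul_eq_cm7Twist hd0 W C hC
  obtain ⟨θ, hθ⟩ := exists_sq_eq_neg_seven_of_cmEndo_mem_endRing W K hj π hrel
  have hd3' : (d / 2) % 4 = 3 := by omega
  -- ramification of the line at `v̄`
  have hram : ¬ GreenbergSelmer.inertia vbar ≤ κ'.kerSubgroup := by
    have h := inertia_not_le_kerSubgroup_of_isUnramifiedOutside (p := 2) hK hκ' (adicCompletionPrime_mem_primesAbove K vbar)
    rwa [inertia_adicCompletionPrime_eq_map_absInertia K vbar] at h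
  obtain ⟨δ₀, hδD, hδκ, hδ₀⟩ := exists_mover_vbar_of_frame_even_three hd0 h2d hd3 W C hC hK v vbar hv hvbar hne π hrel hr hpin κ' hκ'
  exact greenbergKer_strictDatum_eq_awayKer_of_mover κ' hram (isOpen_stabilizer_endEigenPrimaryTorsion _ 2 π r)
    (fun τ hτ hτκ x ↦ smul_eq_self_of_mem_inertia_vbar_of_kerSubgroup_of_frame_even_three hd0 h2d hd3' W C hC hK v vbar hv hvbar hne π hrel hr
      hpin κ' hκ' hτ hτκ x)
    (fun g hg ↦ (mem_kerSubgroup_iff_smul_of_frame hd0 W C hC hK v vbar hv hvbar hne π hrel hr hpin κ' hκ' g).mp hg)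
    hδD hδκ hδ₀ (two_divisible_endEigenPrimaryTorsion W hj hθ π hrel hr) (eq_of_two_nsmul_eq_zero_endEigenPrimaryTorsion W hj hθ π hrel hr)

/-- **`Def(κ′, W*, v̄) = ⊥` on the frames with `d ≡ 6 (mod 16)`**: every LOCAL class of `H¹(ker κ′ ⊓ D_v̄, W*)` dying on `ker κ′ ⊓ I_v̄` is zero — the summand of
`𝓗 = ⊕_{𝔓 ∣ v̄} H¹_nr/H¹_str((K*_∞)_𝔓, W*)` at the chosen place (and, by conjugation, at every place above `v̄`) VANISHES, so `𝓗 = 0` and `e_δ(0, 3) = 0` whatever the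
index set of places is (`localDefect_eq_bot_of_mover` with §1–§2). [cite: GreenbergLNM1716, §3] [cite: Rubin1999, §3 Lemma 3.6 (ii) and Cor. 3.17]
[cite: GreenbergVatsal2000, §2 pp. 17–21] -/
theorem localDefect_vbar_eq_bot_of_frame_even_three {d : ℤ} (hd0 : d ≠ 0) (h2d : (2 : ℤ) ∣ d) (hd3 : (d / 2) % 8 = 3)
    (W : WeierstrassCurve ℚ) [W.IsElliptic] (C : VariableChange ℚ) (hC : C • W = cm7.quadraticTwist (d : ℚ)) (hK : IsImaginaryQuadratic K)
    (v vbar : HeightOneSpectrum (𝓞 K)) (hv : ((2 : ℕ) : 𝓞 K) ∈ v.asIdeal) (hvbar : ((2 : ℕ) : 𝓞 K) ∈ vbar.asIdeal) (hne : vbar ≠ v)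
    (π : (W.baseChange K).endRing) (hrel : (π : AddMonoid.End (W.baseChange K).geomPoints) * π = π - 2) {r : ℤ_[2]} (hr : r * r = r - 2)
    (hpin : ∀ τ ∈ GreenbergSelmer.inertia v, ∀ x : ↥((W.baseChange K).endEigenPrimaryTorsion 2 π r), τ • x = x ∨ τ • x = -x)
    (κ' : ZpExtension K 2) (hκ' : κ'.IsUnramifiedOutside vbar) :
    (resOfLe ↥((W.baseChange K).endEigenPrimaryTorsion 2 π r)
        (inf_le_inf_left κ'.kerSubgroup (GreenbergSelmer.inertia_le_decomp vbar) :
          κ'.kerSubgroup ⊓ GreenbergSelmer.inertia vbar ≤ κ'.kerSubgroup ⊓ GreenbergSelmer.decomp vbar)).ker = ⊥ := by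
  haveI : Fact (Nat.Prime 2) := ⟨Nat.prime_two⟩
  have hj : W.j = -3375 := j_eq_of_smul_eq_cm7Twist hd0 W C hC
  obtain ⟨θ, hθ⟩ := exists_sq_eq_neg_seven_of_cmEndo_mem_endRing W K hj π hrel
  have hd3' : (d / 2) % 4 = 3 := by omega
  have hram : ¬ GreenbergSelmer.inertia vbar ≤ κ'.kerSubgroup := by
    have h := inertia_not_le_kerSubgroup_of_isUnramifiedOutside (p := 2) hK hκ' (adicCompletionPrime_mem_primesAbove K vbar)
    rwa [inertia_adicCompletionPrime_eq_map_absInertia K vbar] at h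
  obtain ⟨δ₀, hδD, hδκ, hδ₀⟩ := exists_mover_vbar_of_frame_even_three hd0 h2d hd3 W C hC hK v vbar hv hvbar hne π hrel hr hpin κ' hκ'
  exact localDefect_eq_bot_of_mover κ' hram (isOpen_stabilizer_endEigenPrimaryTorsion _ 2 π r)
    (fun τ hτ hτκ x ↦ smul_eq_self_of_mem_inertia_vbar_of_kerSubgroup_of_frame_even_three hd0 h2d hd3' W C hC hK v vbar hv hvbar hne π hrel hr
      hpin κ' hκ' hτ hτκ x)
    (fun g hg ↦ (mem_kerSubgroup_iff_smul_of_frame hd0 W C hC hK v vbar hv hvbar hne π hrel hr hpin κ' hκ' g).mp hg)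
    hδD hδκ hδ₀ (two_divisible_endEigenPrimaryTorsion W hj hθ π hrel hr) (eq_of_two_nsmul_eq_zero_endEigenPrimaryTorsion W hj hθ π hrel hr)

end Summit.BirchSwinnertonDyer.BirchSwinnertonDyer.Theorems.PrintCf2.LineLocallyTrivial

end
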